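import Mathlib.Probability.Moments.Variance
import Mathlib.MeasureTheory.Constructions.Pi
import Mathlib.Logic.Equiv.Fin.Basic
import Literature.Computability.Cryptography.LWEProofs
import HarnessLib

/-!
# Sampling lemmas for iid tuples of LWE samples

Toolkit continuing `LWE.lean` / `LWEProofs.lean` (the `m`-fold iid product `iidPMF p m` of a `PMF`):

* `iidPMF_map_comp` — pushing an iid tuple forward coordinatewise gives the iid tuple of the
  push-forward: `(iidPMF p T).map (f ∘ ·) = iidPMF (p.map f) T`;
* `toOuterMeasure_iidPMF_add` — splitting `m + T` iid samples into the first `m` and the last `T`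
  (independence of the two blocks, as an iterated sum over `Fin.appendEquiv`);
* `toOuterMeasure_iidPMF_deviation_le` — the weak law of large numbers (Chebyshev) for the number of
  coordinates of an iid tuple falling in an event `E`: the tuples deviating from `T · p(E)` by at
  least `T η` have mass `≤ 1/(4 T η²)`.  This is `SamplingDeviation.card_deviation_mul_le` with the
  uniform distribution on a finite set replaced by an arbitrary `PMF` on a finite type (same proof:
  Mathlib's `meas_ge_le_variance_div_sq` under `Measure.pi`, `variance_sum_pi`, Bhatia–Davis).

These are the probabilistic plumbing lemmas of the search-to-decision reduction for LWE
(`LWESearchToDecision.lean`).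

## References

* E. Kranakis, *Primality and Cryptography*, Wiley–Teubner 1986, §3.5, Thm. 3.5 (weak law of large
  numbers, Bernoulli case) [Kranakis1986].
* O. Regev, *On lattices, learning with errors, random linear codes, and cryptography*, J. ACM 56
  (2009), §2 (`m` independent samples from `A_{s,χ}`) [RegevLWE2009].
-/

noncomputable section

open scoped ENNReal
open MeasureTheory ProbabilityTheory Finset

namespace Literature.Computability.Cryptography

namespace LWE

variable {α β : Type}

/-! ### Push-forward and splitting of iid tuples -/

/-- Pushing an iid tuple forward coordinatewise yields the iid tuple of the push-forward law:
`(X₁,…,X_T)` iid of law `p` implies `(f X₁, …, f X_T)` iid of law `f_* p`. [folklore] -/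
theorem iidPMF_map_comp (p : PMF α) (f : α → β) :
    ∀ T : ℕ, (iidPMF p T).map (fun v => f ∘ v) = iidPMF (p.map f) T
  | 0 => by
    rw [iidPMF_zero, iidPMF_zero, PMF.pure_map]
    congr 1
    funext i
    exact i.elim0
  | T + 1 => by
    rw [iidPMF_succ, iidPMF_succ, PMF.map_bind, PMF.bind_map]
    congr 1
    funext x
    rw [Function.comp_apply, PMF.map_comp, ← iidPMF_map_comp p f T, PMF.map_comp]
    congr 1
    funext v
    simp only [Function.comp_apply]
    funext i
    refine Fin.cases ?_ (fun j => ?_) i <;> simp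

/-- Mass of an iid tuple (product formula, `LWEProofs.iidPMF_apply_holds`). [cite: RegevLWE2009, §2] -/
theorem iidPMF_apply' (p : PMF α) (T : ℕ) (v : Fin T → α) : iidPMF p T v = ∏ i, p (v i) :=
  iidPMF_apply_holds p T v

/-- The mass of an appended tuple factors into the masses of its two blocks. [folklore] -/
theorem iidPMF_append (p : PMF α) (m T : ℕ) (v₁ : Fin m → α) (v₂ : Fin T → α) :
    iidPMF p (m + T) (Fin.append v₁ v₂) = iidPMF p m v₁ * iidPMF p T v₂ := by
  simp only [iidPMF_apply', Fin.prod_univ_add, Fin.append_left, Fin.append_right]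

/-- **Splitting `m + T` iid samples into two independent blocks.** The mass of an event `E` under
`iidPMF p (m + T)` is the iterated sum, over the first block `v₁` and the last block `v₂`, of
`[Fin.append v₁ v₂ ∈ E] · iidPMF p m v₁ · iidPMF p T v₂`. [folklore] -/
theorem toOuterMeasure_iidPMF_add [Fintype α] (p : PMF α) (m T : ℕ) (E : Set (Fin (m + T) → α))
    [DecidablePred (· ∈ E)] :
    (iidPMF p (m + T)).toOuterMeasure E =
      ∑ v₁ : Fin m → α, ∑ v₂ : Fin T → α,
        if Fin.append v₁ v₂ ∈ E then iidPMF p m v₁ * iidPMF p T v₂ else 0 := by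
  classical
  rw [PMF.toOuterMeasure_apply, tsum_fintype, ← Fintype.sum_prod_type']
  symm
  refine Fintype.sum_equiv (Fin.appendEquiv m T) _ _ (fun w => ?_)
  change _ = E.indicator (⇑(iidPMF p (m + T))) (Fin.append w.1 w.2)
  by_cases h : Fin.append w.1 w.2 ∈ E
  · rw [if_pos h, Set.indicator_of_mem h, iidPMF_append]
  · rw [if_neg h, Set.indicator_of_notMem h]

/-! ### Chebyshev for the number of coordinates in an event -/

/-- **Weak law of large numbers for iid tuples (Chebyshev, counting an event).** For a law `p` on a
finite type, an event `E` of mass `p(E)`, `T ≥ 1` and `η > 0`: the iid tuples `v ∈ α^T` whose number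
of coordinates in `E` deviates from `T · p(E)` by at least `T η` have mass at most `1/(4 T η²)`
(mean `T p(E)`, variance `≤ T/4`). [cite: Kranakis1986, Thm. 3.5] -/
theorem toOuterMeasure_iidPMF_deviation_le [Fintype α] (p : PMF α) (E : Set α)
    {T : ℕ} (hT : 0 < T) {η : ℝ} (hη : 0 < η) :
    (iidPMF p T).toOuterMeasure
        {v | (T : ℝ) * η ≤
          |(∑ i, E.indicator (fun _ => (1 : ℝ)) (v i)) - T * (p.toOuterMeasure E).toReal|}
      ≤ ENNReal.ofReal (1 / (4 * T * η ^ 2)) := by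
  classical
  letI : MeasurableSpace α := ⊤
  haveI : MeasurableSingletonClass α := ⟨fun _ => MeasurableSpace.measurableSet_top⟩
  haveI : Nonempty α := by
    by_contra h
    rw [not_nonempty_iff] at h
    have := PMF.tsum_coe p
    rw [tsum_fintype, Finset.univ_eq_empty, Finset.sum_empty] at this
    exact zero_ne_one this
  -- one trial: the law `p` as a measure, and the indicator `X` of the event
  set μ : Measure α := p.toMeasure with hμ
  set X : α → ℝ := fun a => E.indicator (fun _ => (1 : ℝ)) a with hX
  have hXmeas : Measurable X := measurable_of_finite X
  have hXbdd : ∀ᵐ a ∂μ, X a ∈ Set.Icc (0 : ℝ) 1 :=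
    ae_of_all _ fun a => by
      simp only [hX, Set.indicator_apply]
      split_ifs <;> simp
  have hXLp : MemLp X 2 μ := memLp_of_bounded hXbdd hXmeas.aestronglyMeasurable 2
  set pE : ℝ := (p.toOuterMeasure E).toReal with hpE
  have hsing : ∀ a : α, μ {a} = p a := fun a =>
    PMF.toMeasure_apply_singleton p a (MeasurableSpace.measurableSet_top)
  -- its mean is `p(E)`
  have hmean : μ[X] = pE := by
    classical
    rw [integral_fintype (MemLp.integrable (by norm_num) hXLp)]
    simp only [measureReal_def, hsing, smul_eq_mul, hX, Set.indicator_apply, mul_ite, mul_one,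
      mul_zero]
    rw [Finset.sum_ite, Finset.sum_const_zero, add_zero, hpE,
      ← ENNReal.toReal_sum (fun a _ => PMF.apply_ne_top p a)]
    congr 1
    rw [← PMF.toOuterMeasure_apply_finset]
    congr 1
    ext a
    simp
  -- its variance is at most `1/4`
  have hvar : Var[X; μ] ≤ 1 / 4 := by
    have h := variance_le_sub_mul_sub hXbdd hXmeas.aemeasurable
    nlinarith [h, sq_nonneg (μ[X] - 1 / 2)]
  -- `T` independent trials: the product measure, and the number `S` of coordinates in `E`
  set P : Measure (Fin T → α) := Measure.pi fun _ : Fin T => μ with hP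
  set S : (Fin T → α) → ℝ := ∑ i : Fin T, fun ω => X (ω i) with hS
  have hSLp : MemLp S 2 P := by
    refine memLp_finsetSum' _ fun i _ => ?_
    exact hXLp.comp_measurePreserving (measurePreserving_eval (fun _ : Fin T => μ) i)
  have hSvar : Var[S; P] ≤ T / 4 := by
    rw [hS, hP, variance_sum_pi fun _ => hXLp]
    calc ∑ _i : Fin T, Var[X; μ] ≤ ∑ _i : Fin T, (1 / 4 : ℝ) := Finset.sum_le_sum fun i _ => hvar
      _ = T / 4 := by
          simp only [Finset.sum_const, Finset.card_univ, Fintype.card_fin]; ring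
  have hSmean : P[S] = (T : ℝ) * pE := by
    have hint : ∀ i : Fin T, ∫ ω, X (ω i) ∂P = μ[X] := fun i => by
      have hmp := measurePreserving_eval (fun _ : Fin T => μ) i
      rw [← hmp.map_eq, integral_map (measurable_pi_apply i).aemeasurable
        hXmeas.aestronglyMeasurable]
    have : P[S] = ∑ i : Fin T, ∫ ω, X (ω i) ∂P := by
      rw [hS, ← integral_finsetSum _ fun i _ => ?_]
      · simp only [Finset.sum_apply]
      · exact MemLp.integrable (by norm_num)
          (hXLp.comp_measurePreserving (measurePreserving_eval (fun _ : Fin T => μ) i))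
    rw [this]
    simp only [hint, hmean, Finset.sum_const, Finset.card_univ, Fintype.card_fin, nsmul_eq_mul]
  -- the deviation event IS the Chebyshev tail `{T η ≤ |S - E S|}`
  set B : Finset (Fin T → α) := univ.filter fun ω : Fin T → α => (T : ℝ) * η ≤
    |(∑ i, E.indicator (fun _ => (1 : ℝ)) (ω i)) - T * pE| with hB
  have hSval : ∀ ω, S ω = ∑ i, E.indicator (fun _ => (1 : ℝ)) (ω i) := fun ω => by
    rw [hS, Finset.sum_apply]
  have hsub : (B : Set (Fin T → α)) ⊆ {ω | (T : ℝ) * η ≤ |S ω - P[S]|} := by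
    intro ω hω
    rw [Finset.mem_coe, hB, Finset.mem_filter] at hω
    rw [Set.mem_setOf_eq, hSval ω, hSmean]
    exact hω.2
  have hcheb := meas_ge_le_variance_div_sq hSLp (c := (T : ℝ) * η) (by positivity)
  have hPB : P B ≤ ENNReal.ofReal (1 / (4 * T * η ^ 2)) := by
    refine ((measure_mono hsub).trans hcheb).trans (ENNReal.ofReal_le_ofReal ?_)
    rw [div_le_div_iff₀ (by positivity) (by positivity)]
    have hT' : (1 : ℝ) ≤ T := by exact_mod_cast hT
    nlinarith [hSvar, sq_nonneg η, mul_pos (show (0:ℝ) < T by positivity) (sq_pos_of_pos hη)]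
  -- the product measure of `B` is its `iidPMF` mass
  have hPB' : P B = (iidPMF p T).toOuterMeasure B := by
    rw [← MeasureTheory.sum_measure_singleton, PMF.toOuterMeasure_apply_finset]
    refine Finset.sum_congr rfl fun v _ => ?_
    rw [hP, Measure.pi_singleton, iidPMF_apply']
    simp only [hsing]
  have hBE : (B : Set (Fin T → α)) =
      {v | (T : ℝ) * η ≤ |(∑ i, E.indicator (fun _ => (1 : ℝ)) (v i)) - T * pE|} := by
    ext v
    simp [hB]
  rw [← hBE, ← hPB']
  exact hPB

end LWE

end Literature.Computability.Cryptography

end
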